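import Summits.ValiantsHypothesis.ValiantsHypothesis.Theorems.BarrierLeverChowHitsThinRowPartitionMinorsRBigStarRelabel

/-!
# Route BarrierLever — item `ChowHitsThinRowPartitionMinorsR` (stmt-ValiantsHypothesis-21850, budget
# `h·h`): a star of x-dedicated pair rows with arbitrary leaf labels

Helper file (`--supports stmt-ValiantsHypothesis-21850`; cell valiant-natproofs, rung V4, 𝒟-side;
seat val-np-p5 gen 28).  Closes NO item by itself; definition-free; imports `…RBigStarRelabel`.

**`chowHitsHH_of_xdedBigStar`.**  Rows `u` (injective, thin) with a star of triangles — singleton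
rows `{a₀}`, `{x}` and pair rows `{a₀, x}`, `x ∈ B` — against columns `w` with a down-closed
injective monomial basis `U` (`det [U i ⊆ w j] ≠ 0`) containing `{v₀}` and `|B|` further distinct sets
`T x ∋ v₀`; if `|Cu| + #singles + 2·#pairs ≤ #SLab + 2·|B| + h·h` (`SLab` = singleton labels of `U`,
`Cu` = used coordinates; i.e. «affine defect ≤ 2·|B| + slack»), the layout is hit by `h·h` affine
forms: every pair row `{a₀, x}` is x-DEDICATED with label `T x = {v₀} ⊔ (T x ∖ v₀)` and saves its two
gadget forms (`exists_bigStarRelabel` + `chowHitsHH_of_labels_xded`, p695022).  Unlike the Star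
theorem (pair labels `{v₀, v}` only) the supply of labels `T ∋ v₀` is as large as the basis itself,
which is what closes the near-full case in `…RNearFullAll`.

WHAT THIS IS NOT: nothing on items 21882 / 19717, on crux stmt-ValiantsHypothesis-14610, or on `VP`
versus `VNP`.
-/

set_option linter.dupNamespace false

namespace Summit.ValiantsHypothesis.ValiantsHypothesis.Theorems.BarrierLever.ChowThinHH

open Finset MvPolynomial

variable {h r : ℕ}

/-- **Big-leaf star of x-dedicated pairs ⇒ hit** (see the module docstring). -/
theorem chowHitsHH_of_xdedBigStar (h r : ℕ) (u w : Fin r → Finset (Fin h))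
    (hu : Function.Injective u) (hu2 : ∀ i, (u i).card ≤ 2)
    (U : Fin r → Finset (Fin h)) (hUinj : Function.Injective U)
    (hUdown : ∀ i (S : Finset (Fin h)), S ⊆ U i → ∃ i', U i' = S)
    (hZ : (Matrix.of fun i j : Fin r => if U i ⊆ w j then (1 : ℂ) else 0).det ≠ 0)
    (a₀ : Fin h) (B : Finset (Fin h)) (haB : a₀ ∉ B)
    (σ : Fin h → Fin r) (hσ : ∀ x ∈ insert a₀ B, u (σ x) = {x})
    (ρ : Fin h → Fin r) (hρ : ∀ x ∈ B, u (ρ x) = {a₀, x})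
    (v₀ : Fin h) (hv₀U : ∃ j, U j = {v₀})
    (T : Fin h → Finset (Fin h)) (hT : ∀ x ∈ B, ∃ j, U j = T x) (hTv : ∀ x ∈ B, v₀ ∈ T x)
    (hT2 : ∀ x ∈ B, 2 ≤ (T x).card) (hTinj : Set.InjOn T B)
    (hdef : (Finset.univ.biUnion w).card + (Finset.univ.filter fun i : Fin r => (u i).card = 1).card +
        2 * (Finset.univ.filter fun i : Fin r => (u i).card = 2).card ≤
      (Finset.univ.filter fun j : Fin r => (U j).card = 1).card + 2 * B.card + h * h) :
    ∃ ℓ : Fin (h * h) → MvPolynomial (Fin (h + h)) ℂ, (∀ k, (ℓ k).totalDegree ≤ 1) ∧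
      (Matrix.of fun i j : Fin r => MvPolynomial.coeff
        (∑ a ∈ u i, Finsupp.single (Fin.castAdd h a) 1 +
          ∑ c ∈ w j, Finsupp.single (Fin.natAdd h c) 1) (∏ k, ℓ k)).det ≠ 0 := by
  classical
  obtain ⟨U', hU'inj, hU'down, hU'empty, hZ', hU'a, hU'σ, hU'ρ, hcost⟩ :=
    exists_bigStarRelabel u w hu U hUinj hUdown hZ a₀ B haB σ hσ ρ hρ v₀ hv₀U T hT hTv hT2 hTinj
  set Sing : Finset (Fin r) := Finset.univ.filter fun i : Fin r => (u i).card = 1 with hSing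
  set Pairs : Finset (Fin r) := Finset.univ.filter fun i : Fin r => (u i).card = 2 with hPairs
  set SLab : Finset (Fin r) := Finset.univ.filter fun j : Fin r => (U j).card = 1 with hSLab
  set Cu : Finset (Fin h) := Finset.univ.biUnion w with hCu
  have hxa : ∀ x ∈ B, x ≠ a₀ := fun x hx e => haB (e ▸ hx)
  have hρcard : ∀ x ∈ B, (u (ρ x)).card = 2 := fun x hx => by
    rw [hρ x hx, Finset.card_pair (hxa x hx).symm]
  have hρinj : Set.InjOn ρ B := by
    intro x hx x' hx' e
    have e2 : ({a₀, x} : Finset (Fin h)) = {a₀, x'} :=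
      (hρ x hx).symm.trans ((congrArg u e).trans (hρ x' hx'))
    have hx2 : x ∈ ({a₀, x'} : Finset (Fin h)) := by rw [← e2]; simp
    rcases Finset.mem_insert.mp hx2 with h1 | h1
    · exact absurd h1 (hxa x hx)
    · exact Finset.mem_singleton.mp h1
  have ha0 : a₀ ∈ insert a₀ B := Finset.mem_insert_self _ _
  refine chowHitsHH_of_labels_xded h r u w hu hu2 U' hU'inj hU'down hU'empty hZ' (B.image ρ) ?_ ?_ ?_
  · intro i hi
    obtain ⟨x, hx, rfl⟩ := Finset.mem_image.mp hi
    exact hρcard x hx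
  · intro i hi
    obtain ⟨x, hx, rfl⟩ := Finset.mem_image.mp hi
    have hxB : x ∈ insert a₀ B := Finset.mem_insert_of_mem hx
    refine ⟨σ a₀, σ x, by rw [hσ a₀ ha0, Finset.card_singleton],
      by rw [hσ x hxB, Finset.card_singleton], ?_, ?_, ?_⟩
    · rw [hρ x hx, hσ a₀ ha0, hσ x hxB]; rfl
    · rw [hU'ρ x hx, hU'a, hU'σ x hx, ← Finset.insert_eq, Finset.insert_erase (hTv x hx)]
    · rw [hU'a, hU'σ x hx]
      exact Finset.disjoint_singleton_left.mpr (Finset.notMem_erase v₀ (T x))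
  -- budget
  have hXsub : B.image ρ ⊆ Pairs := by
    intro i hi
    obtain ⟨x, hx, rfl⟩ := Finset.mem_image.mp hi
    exact Finset.mem_filter.mpr ⟨Finset.mem_univ _, hρcard x hx⟩
  have hXcard : (B.image ρ).card = B.card := Finset.card_image_of_injOn hρinj
  have hBle : B.card ≤ Pairs.card := by rw [← hXcard]; exact Finset.card_le_card hXsub
  have hCu_h : Cu.card ≤ h := (Finset.card_le_univ _).trans (by rw [Fintype.card_fin])
  have hpairs : Pairs.card ≤ h.choose 2 := card_pairRows_le u hu
  have h3 := add_two_mul_choose_two h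
  show (Sing.image U' ∪ Cu.image (fun c : Fin h => ({c} : Finset (Fin h)))).card +
      2 * (Pairs \ B.image ρ).card ≤ h * h
  rw [Finset.card_sdiff_of_subset hXsub, hXcard]
  rcases hcost with h1 | h1
  · omega
  · omega

end Summit.ValiantsHypothesis.ValiantsHypothesis.Theorems.BarrierLever.ChowThinHH
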